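import Mathlib
import HarnessLib

/-!
# The weight obstruction behind Fin_v at a split prime: `π² ∉ ℚ`, and no unit-root relation
# `± α^h · φ(π)² = p^{2h}` in any characteristic-zero field

Seat `bsd-schneider-door-c5` (cell `bsd-schneider-ideate`), gen 5; route `SchneiderFreeAdditiveX3`, crux
r5 `LocalTowerTorsionFiniteX3` (stmt-BirchSwinnertonDyer-19546).  Companion of
`SchneiderFreeAdditiveX3LocalTowerTorsionLine.lean`, which reduced Fin_v on the door's cells to ONE
element of `D_𝔭 ⊓ ker κ` moving the canonical line `C₀`.  The element is the local norm residue symbol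
`σ₀` of `x = π²/p^h` at the split prime `𝔭` (`𝔭^h = (π)`; Literature fact
`ZpExtension.exists_isFrobPow_mem_kerSubgroup_of_isAnticyclotomic`): it has cyclotomic character
`ε(σ₀) = p^{2h}/φ(π)²` (`φ` the `𝔭`-adic embedding) and Frobenius degree `h`, so it fixes `C₀` pointwise
only if the character `ψ·ε·unr(α)⁻¹` of `C₀` (`α` the unit root of the semistable twist at `p`,
`α² = a α − p`; `ψ = ±1`) takes the value `1` at `σ₀`, i.e. only if

  `± α^h · φ(π)² = p^{2h}`   (potentially good ordinary)   resp.   `± φ(π)² = p^{2h}`   (pot. multiplicative).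

This file proves that NO such relation holds — the "weight" obstruction of the memo (ROUTE-P2 L45:
`|α| = √p` versus `|π̄/π| = 1`), in exact algebraic form and with no archimedean input:

* §1 `false_of_unitRoot_sq_relation` (abstract): for a ring `A`, an injective ring map `φ : A → R`
  into a field of characteristic `0`, `π ∈ A` with an integral quadratic relation
  `b π⁴ − t π² + b p^{2h} = 0` (`b ≠ 0`) and `π²` irrational (`D π² ≠ N` for integers `D ≠ 0`), and
  `α ∈ R` with `α² = aα − p`: the relation `s α^h φ(π)² = p^{2h}` (`s = ±1`, `h ≥ 1`) is impossible
  (with `α' = a − α`: `φ(π²) = s p^h α'^h` has norm-type relation `y² − s p^h S_h y + p^{3h} = 0`,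
  `S_h = α^h + α'^h ∈ ℤ`, against `y² − (t/b) y + p^{2h} = 0`; subtracting makes `y` rational);
  `false_of_sq_relation`: likewise `s φ(π)² = p^{2h}` is impossible.
* §2 the arithmetic of a degree-one prime of a quadratic field supplying the two hypotheses:
  `natAbs_norm_eq_of_span_eq_pow` (`|N(π)| = p^h`), `sq_mul_ne_intCast_of_span_eq_pow`
  (**`π²` is irrational**: `D π² = N` forces `π² = ±p^h`, i.e. `p^h ∈ 𝔭^{2h}`, against `e(𝔭|p) = 1`),
  `exists_quartic_relation_of_finrank_eq_two` (the Galois conjugate gives `b π⁴ − t π² + b·N(π)² = 0`);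
  capstones `ne_of_unitRoot_of_span_eq_pow` / `ne_of_span_eq_pow` (the two cells).

Proofs only (no definition, no named fact, no `sorry`); closes nothing by itself (helper `--supports
stmt-BirchSwinnertonDyer-19546`); BSD is not advanced by any of this.

## References

* [JetchevSkinnerWan2017] D. Jetchev, C. Skinner, X. Wan, Camb. J. Math. 5 (2017), §3.3 Prop. 3.3.4
  Case 3(b) (arXiv:1512.06894 p. 13: "`α(Frob_v)` is a Weil number of absolute value `p^{−1/2+a}` …
  contradicting it being a character of weight `−1`").
* [GreenbergLNM1716] R. Greenberg, LNM 1716 (1999), §2 p. 62–63 (the unit root `α`, `αβ = p`).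
-/

namespace Summit.BirchSwinnertonDyer.BirchSwinnertonDyer.Theorems.SchneiderFreeAdditiveX3

open NumberField IsDedekindDomain

set_option linter.dupNamespace false

/-! ## §1. No unit-root relation in a characteristic-zero field -/

section Abstract

variable {R : Type*} [Field R] [CharZero R]

omit [CharZero R] in
/-- The power sums `α^n + α'^n` of the two roots of `X² − aX + p` are integers: with `S₀ = 2`,
`S₁ = a`, `S_{n+2} = a S_{n+1} − p S_n`. [folklore] -/
theorem exists_int_powSum_eq (a p : ℤ) {α α' : R} (hsum : α + α' = a) (hprod : α * α' = p) :
    ∀ n : ℕ, ∃ S : ℤ, α ^ n + α' ^ n = (S : R) := by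
  -- strong induction via pairs
  have key : ∀ n : ℕ, (∃ S : ℤ, α ^ n + α' ^ n = (S : R)) ∧
      ∃ S : ℤ, α ^ (n + 1) + α' ^ (n + 1) = (S : R) := by
    intro n
    induction n with
    | zero => exact ⟨⟨2, by norm_num⟩, ⟨a, by rw [pow_one, pow_one, hsum]⟩⟩
    | succ n ih =>
      obtain ⟨⟨S₀, h₀⟩, ⟨S₁, h₁⟩⟩ := ih
      refine ⟨⟨S₁, h₁⟩, ⟨a * S₁ - p * S₀, ?_⟩⟩
      have : α ^ (n + 2) + α' ^ (n + 2) =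
          (α + α') * (α ^ (n + 1) + α' ^ (n + 1)) - α * α' * (α ^ n + α' ^ n) := by ring
      rw [this, hsum, hprod, h₁, h₀]
      push_cast
      ring
  exact fun n ↦ (key n).1

/-- **No unit-root relation.**  `φ : A → R` an injective ring map into a field of characteristic `0`;
`π ∈ A` with `b π⁴ − t π² + b p^{2h} = 0` (`b ≠ 0`; for `A = 𝓞_K`, `K` imaginary quadratic and
`(π) = 𝔭^h` at a split `p`: `t/b = π² + π̄²`, `N(π)² = p^{2h}`) and `π²` irrational (`D π² ≠ N` for
all integers `D ≠ 0`, `N`); `α ∈ R` with `α² = aα − p` (`a ∈ ℤ`; the unit root of the semistable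
twist).  Then `s α^h φ(π)² ≠ p^{2h}` for `s = ±1`, `h ≥ 1`: otherwise, with `α' = a − α`
(`αα' = p`), `y = φ(π²) = s p^h α'^h` satisfies `y² − s p^h S_h y + p^{3h} = 0`
(`S_h = α^h + α'^h ∈ ℤ`) and `b y² − t y + b p^{2h} = 0`, so `(s p^h S_h b − t) y = b(p^{3h} − p^{2h})`
makes `π²` rational.  (JSW17's "weight" contradiction `|α| = √p` in exact form.)
[cite: JetchevSkinnerWan2017, §3.3 Prop. 3.3.4 Case 3(b) (arXiv:1512.06894 p. 13)] -/
theorem false_of_unitRoot_sq_relation {A : Type*} [CommRing A] (φ : A →+* R)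
    (hφ : Function.Injective φ) {p : ℕ} (hp : p.Prime) {h : ℕ} (hh : 0 < h) {π : A} {b t : ℤ}
    (hb : b ≠ 0) (hrel : (b : A) * π ^ 4 - t * π ^ 2 + b * (p : A) ^ (2 * h) = 0)
    (hirr : ∀ D N : ℤ, D ≠ 0 → (D : A) * π ^ 2 ≠ N)
    {a : ℤ} {α : R} (hα : α ^ 2 = a * α - p) {s : ℤ} (hs : s = 1 ∨ s = -1)
    (H : (s : R) * α ^ h * φ π ^ 2 = (p : R) ^ (2 * h)) : False := by
  set α' : R := a - α with hα'
  have hsum : α + α' = a := by rw [hα']; ring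
  have hprod : α * α' = p := by
    rw [hα', mul_sub, ← sq, hα]; ring
  have hss : (s : R) * s = 1 := by
    rcases hs with rfl | rfl <;> push_cast <;> norm_num
  have hp0 : (p : R) ≠ 0 := Nat.cast_ne_zero.mpr hp.ne_zero
  set y : R := φ π ^ 2 with hy
  -- `y = s p^h α'^h`
  have hy1 : y = s * (p : R) ^ h * α' ^ h := by
    have h1 : (s : R) * (α * α') ^ h * y = (p : R) ^ (2 * h) * α' ^ h := by
      rw [mul_pow, ← H]; ring
    rw [hprod] at h1
    have h2 : (p : R) ^ h * ((s : R) * y) = (p : R) ^ h * ((p : R) ^ h * α' ^ h) := by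
      rw [← mul_assoc, mul_comm ((p : R) ^ h), h1, two_mul, pow_add]; ring
    have h3 := mul_left_cancel₀ (pow_ne_zero h hp0) h2
    calc y = (s : R) * s * y := by rw [hss, one_mul]
      _ = s * ((s : R) * y) := by ring
      _ = s * (p : R) ^ h * α' ^ h := by rw [h3]; ring
  -- the norm-type relation `y² − s p^h S_h y + p^{3h} = 0`
  obtain ⟨S, hS⟩ := exists_int_powSum_eq a (p : ℤ) hsum (by push_cast; exact hprod) h
  have hQ : y ^ 2 - s * (p : R) ^ h * S * y + (p : R) ^ (3 * h) = 0 := by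
    have e1 : y ^ 2 = (p : R) ^ (2 * h) * α' ^ (2 * h) := by
      rw [hy1, mul_pow, mul_pow, ← pow_mul, ← pow_mul, ← Int.cast_pow, sq s]
      rcases hs with rfl | rfl <;> push_cast <;> ring
    have e2 : (s : R) * (p : R) ^ h * S * y = (p : R) ^ (2 * h) * ((α * α') ^ h + α' ^ (2 * h)) := by
      rw [← hS, hy1, mul_pow]
      have : (s : R) * (p : R) ^ h * (α ^ h + α' ^ h) * (s * (p : R) ^ h * α' ^ h) =
          (s : R) * s * ((p : R) ^ h * (p : R) ^ h) * (α ^ h * α' ^ h + α' ^ h * α' ^ h) := by ring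
      rw [this, hss, one_mul, ← pow_add, ← pow_add, ← two_mul]
    rw [e1, e2, hprod]
    have : (p : R) ^ (2 * h) * ((p : R) ^ h + α' ^ (2 * h)) =
        (p : R) ^ (2 * h) * α' ^ (2 * h) + (p : R) ^ (3 * h) := by
      rw [show 3 * h = 2 * h + h by ring, pow_add]; ring
    rw [this]; ring
  -- the relation from `A`: `b y² − t y + b p^{2h} = 0`
  have hP : (b : R) * y ^ 2 - t * y + b * (p : R) ^ (2 * h) = 0 := by
    have := congrArg φ hrel
    simp only [map_add, map_sub, map_mul, map_pow, map_intCast, map_natCast, map_zero] at this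
    rw [hy, ← pow_mul]
    linear_combination this
  -- eliminate `y²`: `(s p^h S b − t) y = b (p^{3h} − p^{2h})`
  have hlin : ((s * (p : ℤ) ^ h * S * b - t : ℤ) : R) * y =
      ((b * ((p : ℤ) ^ (3 * h) - (p : ℤ) ^ (2 * h)) : ℤ) : R) := by
    push_cast
    linear_combination hP - (b : R) * hQ
  set D : ℤ := s * (p : ℤ) ^ h * S * b - t with hD
  set N : ℤ := b * ((p : ℤ) ^ (3 * h) - (p : ℤ) ^ (2 * h)) with hN
  have hN0 : N ≠ 0 := by
    rw [hN]
    refine mul_ne_zero hb (sub_ne_zero.mpr ?_)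
    intro heq
    have hp1 : 1 < (p : ℤ) := by exact_mod_cast hp.one_lt
    have : 2 * h < 3 * h := by omega
    exact absurd heq (ne_of_gt (pow_lt_pow_right₀ hp1 this))
  by_cases hD0 : D = 0
  · rw [hD0, Int.cast_zero, zero_mul] at hlin
    exact hN0 (by exact_mod_cast hlin.symm)
  · -- `D • π² = N` in `A` by injectivity of `φ`
    apply hirr D N hD0
    apply hφ
    rw [map_mul, map_intCast, map_pow, map_intCast, ← hy]
    exact hlin

omit [CharZero R] in
/-- **No rational relation either** (the potentially multiplicative cell, where the canonical line is
the Tate line and its character is `±ε`): `s φ(π)² ≠ p^{2h}` for `s = ±1`, since `π²` is irrational.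
[cite: JetchevSkinnerWan2017, §3.3 Prop. 3.3.4 Case 3(b), case (ii) (arXiv:1512.06894 p. 13)] -/
theorem false_of_sq_relation {A : Type*} [CommRing A] (φ : A →+* R) (hφ : Function.Injective φ)
    {p : ℕ} {h : ℕ} {π : A} (hirr : ∀ D N : ℤ, D ≠ 0 → (D : A) * π ^ 2 ≠ N)
    {s : ℤ} (hs : s = 1 ∨ s = -1) (H : (s : R) * φ π ^ 2 = (p : R) ^ (2 * h)) : False := by
  have hs0 : s ≠ 0 := by rcases hs with rfl | rfl <;> norm_num
  apply hirr s ((p : ℤ) ^ (2 * h)) hs0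
  apply hφ
  rw [map_mul, map_intCast, map_pow, map_intCast]
  push_cast
  exact H

end Abstract

/-! ## §2. The degree-one prime of a quadratic field: `|N(π)| = p^h`, `π²` irrational, the quartic -/

section Quadratic

variable {K : Type*} [Field K] [NumberField K]

/-- `|N_{K/ℚ}(π)| = p^h` when `(π) = 𝔭^h` with `N(𝔭) = p` (`Ideal.absNorm` is multiplicative and
`N((π)) = |N(π)|`, Mathlib `Ideal.absNorm_span_singleton`). [folklore] -/
theorem natAbs_norm_eq_of_span_eq_pow {𝔭 : Ideal (𝓞 K)} {p h : ℕ} (hN : Ideal.absNorm 𝔭 = p)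
    {π : 𝓞 K} (hπ : 𝔭 ^ h = Ideal.span {π}) : (Algebra.norm ℤ π).natAbs = p ^ h := by
  rw [← Ideal.absNorm_span_singleton, ← hπ, map_pow, hN]

/-- An integer `D` has `|N_{K/ℚ}(D)| = |D|^{[K:ℚ]}`. [folklore] -/
theorem natAbs_norm_intCast (D : ℤ) :
    (Algebra.norm ℤ (D : 𝓞 K)).natAbs = D.natAbs ^ Module.finrank ℚ K := by
  have h : Algebra.norm ℤ ((algebraMap ℤ (𝓞 K)) D) = D ^ Module.finrank ℤ (𝓞 K) :=
    Algebra.norm_algebraMap D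
  rw [eq_intCast] at h
  rw [h, Int.natAbs_pow, NumberField.RingOfIntegers.rank]

/-- **`π²` is irrational** at a degree-one prime: for `[K:ℚ] = 2`, `𝔭` a prime of `𝓞_K` with
`N(𝔭) = p`, `p ∉ 𝔭²` (`e(𝔭|p) = 1`), `h ≥ 1` and `(π) = 𝔭^h`, no integers `D ≠ 0`, `N` satisfy
`D π² = N`: taking ideal norms gives `D² p^{2h} = N²`, so `N = ±D p^h`, `π² = ±p^h`, and
`p^h ∈ (π²) = 𝔭^{2h} ⊆ 𝔭^{h+1}`, contradicting `v_𝔭(p^h) = h`. [folklore] -/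
theorem sq_mul_ne_intCast_of_span_eq_pow (hK : Module.finrank ℚ K = 2) {𝔭 : Ideal (𝓞 K)}
    (h𝔭 : 𝔭.IsPrime) {p : ℕ} (hp : p.Prime) (hN : Ideal.absNorm 𝔭 = p) (hp𝔭 : (p : 𝓞 K) ∈ 𝔭)
    (hp2 : (p : 𝓞 K) ∉ 𝔭 ^ 2) {h : ℕ} (hh : 0 < h) {π : 𝓞 K} (hπ : 𝔭 ^ h = Ideal.span {π})
    (D N : ℤ) (hD : D ≠ 0) : (D : 𝓞 K) * π ^ 2 ≠ N := by
  intro hDN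
  -- ideal norms: `|D|² · p^{2h} = |N|²`
  have hnorm : D.natAbs ^ 2 * p ^ (2 * h) = N.natAbs ^ 2 := by
    have h1 := congrArg (fun z : 𝓞 K ↦ (Algebra.norm ℤ z).natAbs) hDN
    simp only [map_mul, map_pow, Int.natAbs_mul, Int.natAbs_pow] at h1
    rw [natAbs_norm_intCast, natAbs_norm_intCast, hK, natAbs_norm_eq_of_span_eq_pow hN hπ,
      ← pow_mul, mul_comm h 2] at h1
    exact h1
  -- hence `|N| = |D| p^h`
  have habs : N.natAbs = D.natAbs * p ^ h := by
    have : (D.natAbs * p ^ h) ^ 2 = N.natAbs ^ 2 := by rw [mul_pow, ← pow_mul, mul_comm h 2, hnorm]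
    exact (Nat.pow_left_injective two_ne_zero this).symm
  -- so `N = ± D p^h` and `D π² = ± D p^h`, `π² = ± p^h`
  have hπ2 : π ^ 2 = (p : 𝓞 K) ^ h ∨ π ^ 2 = -(p : 𝓞 K) ^ h := by
    have hD' : (D : 𝓞 K) ≠ 0 := by exact_mod_cast hD
    have hcases : N = D * (p : ℤ) ^ h ∨ N = -(D * (p : ℤ) ^ h) := by
      have h1 : N.natAbs = (D * (p : ℤ) ^ h).natAbs := by
        rw [Int.natAbs_mul, Int.natAbs_pow, Int.natAbs_natCast, habs]
      exact Int.natAbs_eq_natAbs_iff.mp h1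
    rcases hcases with hc | hc
    · left
      apply mul_left_cancel₀ hD'
      rw [hDN, hc]; push_cast; ring
    · right
      apply mul_left_cancel₀ hD'
      rw [hDN, hc]; push_cast; ring
  -- `p^h ∈ 𝔭^{2h}`
  have hmem : (p : 𝓞 K) ^ h ∈ 𝔭 ^ (2 * h) := by
    have hsq : π ^ 2 ∈ 𝔭 ^ (2 * h) := by
      rw [mul_comm, pow_mul, hπ, Ideal.span_singleton_pow]
      exact Ideal.mem_span_singleton_self _
    rcases hπ2 with h2 | h2
    · rwa [h2] at hsq
    · rw [h2] at hsq
      simpa using (𝔭 ^ (2 * h)).neg_mem hsq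
  -- but `v_𝔭(p^h) = h < 2h`: `p^h ∉ 𝔭^{h+1}`
  have hle : 𝔭 ^ (2 * h) ≤ 𝔭 ^ (h + 1) := Ideal.pow_le_pow_right (by omega)
  have hmem' : (p : 𝓞 K) ^ h ∈ 𝔭 ^ (h + 1) := hle hmem
  -- `p^h ∉ 𝔭^{h+1}` from `p ∉ 𝔭²` in the Dedekind domain `𝓞 K`
  have h𝔭0 : 𝔭 ≠ ⊥ := by
    rintro rfl
    rw [Submodule.mem_bot] at hp𝔭
    exact hp.ne_zero (by exact_mod_cast hp𝔭)
  haveI := h𝔭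
  have hprime : Prime 𝔭 := Ideal.prime_of_isPrime h𝔭0 h𝔭
  -- count `𝔭` in `(p)^h = (p^h)`: `v_𝔭((p)) = 1`
  have hcount1 : ¬ 𝔭 ^ 2 ∣ Ideal.span {(p : 𝓞 K)} := by
    rw [Ideal.dvd_span_singleton]; exact hp2
  have hdvd : 𝔭 ^ (h + 1) ∣ Ideal.span {(p : 𝓞 K)} ^ h := by
    rw [Ideal.span_singleton_pow, Ideal.dvd_span_singleton]; exact hmem'
  -- `𝔭^{h+1} ∣ (p)^h` with `𝔭² ∤ (p)` is impossible: compare multiplicities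
  have hmult_le : emultiplicity 𝔭 (Ideal.span {(p : 𝓞 K)}) ≤ 1 := by
    by_contra hlt
    push Not at hlt
    have h2 : (1 : ℕ∞) + 1 ≤ emultiplicity 𝔭 (Ideal.span {(p : 𝓞 K)}) := Order.add_one_le_of_lt hlt
    exact hcount1 (pow_dvd_of_le_emultiplicity (by simpa [one_add_one_eq_two] using h2))
  have hge : ((h : ℕ∞) + 1) ≤ h * emultiplicity 𝔭 (Ideal.span {(p : 𝓞 K)}) := by
    have h1 := le_emultiplicity_of_pow_dvd hdvd
    rw [emultiplicity_pow hprime, Nat.cast_add, Nat.cast_one] at h1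
    exact h1
  have hle' : (h : ℕ∞) + 1 ≤ h :=
    calc (h : ℕ∞) + 1 ≤ h * emultiplicity 𝔭 (Ideal.span {(p : 𝓞 K)}) := hge
      _ ≤ h * 1 := by gcongr
      _ = h := mul_one _
  exact absurd ((ENat.add_one_le_iff (ENat.coe_ne_top h)).mp hle') (lt_irrefl _)


/-- In a quadratic number field there is a non-trivial automorphism `c`, every automorphism is `1` or
`c`, and `c² = 1` (`#Gal(K/ℚ) = [K:ℚ] = 2`, a quadratic extension in characteristic `0` being Galois).
[folklore] -/
theorem exists_aut_of_finrank_eq_two (hK : Module.finrank ℚ K = 2) :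
    ∃ c : K ≃ₐ[ℚ] K, c ≠ 1 ∧ (∀ σ : K ≃ₐ[ℚ] K, σ = 1 ∨ σ = c) ∧ c * c = 1 := by
  haveI : Algebra.IsQuadraticExtension ℚ K := ⟨hK⟩
  have hcard : Nat.card (K ≃ₐ[ℚ] K) = 2 := by rw [IsGalois.card_aut_eq_finrank, hK]
  obtain ⟨c, hc1, huniq⟩ := (Nat.card_eq_two_iff' (1 : K ≃ₐ[ℚ] K)).mp hcard
  have hdich : ∀ σ : K ≃ₐ[ℚ] K, σ = 1 ∨ σ = c := fun σ ↦ by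
    by_cases h : σ = 1
    · exact Or.inl h
    · exact Or.inr (huniq σ h)
  refine ⟨c, hc1, hdich, ?_⟩
  rcases hdich (c * c) with h | h
  · exact h
  · exact absurd (mul_left_cancel (a := c) (by rw [h, mul_one])) hc1

/-- **The quartic relation.**  For `[K:ℚ] = 2`, a prime `𝔭` of `𝓞_K` with `N(𝔭) = p` and
`(π) = 𝔭^h`: there are integers `b ≠ 0`, `t` with `b π⁴ − t π² + b p^{2h} = 0` in `𝓞_K` — namely
`π²` is a root of `X² − tr(π²) X + N(π²)` with `tr(π²) = π² + π̄² = t/b ∈ ℚ` and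
`N(π²) = N(π)² = p^{2h}` (`|N(π)| = N((π)) = N(𝔭)^h`). [folklore] -/
theorem exists_quartic_relation_of_finrank_eq_two (hK : Module.finrank ℚ K = 2) {𝔭 : Ideal (𝓞 K)}
    {p h : ℕ} (hN : Ideal.absNorm 𝔭 = p) {π : 𝓞 K} (hπ : 𝔭 ^ h = Ideal.span {π}) :
    ∃ b t : ℤ, b ≠ 0 ∧ (b : 𝓞 K) * π ^ 4 - t * π ^ 2 + b * (p : 𝓞 K) ^ (2 * h) = 0 := by
  classical
  haveI : Algebra.IsQuadraticExtension ℚ K := ⟨hK⟩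
  obtain ⟨c, hc1, hdich, hcc⟩ := exists_aut_of_finrank_eq_two hK
  have huniv : (Finset.univ : Finset (K ≃ₐ[ℚ] K)) = {1, c} := by
    ext σ
    simp only [Finset.mem_univ, Finset.mem_insert, Finset.mem_singleton, true_iff]
    exact hdich σ
  set x : K := ((π : 𝓞 K) : K) with hx
  set N : ℚ := Algebra.norm ℚ x with hNdef
  -- the norm: `x · c x = N`, `N² = p^{2h}`
  have hnorm : x * c x = algebraMap ℚ K N := by
    rw [hNdef, Algebra.norm_eq_prod_automorphisms, huniv, Finset.prod_pair hc1.symm, AlgEquiv.one_apply]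
  have hnormval : N ^ 2 = (p : ℚ) ^ (2 * h) := by
    have h1 : N = ((Algebra.norm ℤ π : ℤ) : ℚ) := (Algebra.coe_norm_int π).symm
    have h2 : (Algebra.norm ℤ π).natAbs = p ^ h := natAbs_norm_eq_of_span_eq_pow hN hπ
    rw [h1, ← Int.cast_pow, ← Int.natAbs_sq, h2]
    push_cast
    ring
  -- the trace: `x + c x = T ∈ ℚ`
  have htrace : ∃ T : ℚ, algebraMap ℚ K T = x + c x := by
    have hfix : ∀ f : K ≃ₐ[ℚ] K, f (x + c x) = x + c x := fun f ↦ by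
      rcases hdich f with rfl | rfl
      · rfl
      · rw [map_add, ← AlgEquiv.mul_apply, hcc, AlgEquiv.one_apply, add_comm]
    exact (IsGalois.mem_range_algebraMap_iff_fixed (x + c x)).mpr hfix
  obtain ⟨T, hT⟩ := htrace
  -- `x` is a root of `(X − x)(X − c x) = X² − T X + N`
  have hquad : x ^ 2 - algebraMap ℚ K T * x + algebraMap ℚ K N = 0 := by
    rw [hT, ← hnorm]; ring
  -- hence `x² = π²` is a root of `Y² − (T² − 2N) Y + N²`, and `N² = p^{2h}`
  set T₂ : ℚ := T ^ 2 - 2 * N with hT₂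
  have hN2 : (algebraMap ℚ K N) ^ 2 = (p : K) ^ (2 * h) := by
    rw [← map_pow, hnormval, map_pow, map_natCast]
  have hquart : x ^ 4 - algebraMap ℚ K T₂ * x ^ 2 + (p : K) ^ (2 * h) = 0 := by
    rw [← hN2, hT₂, map_sub, map_mul, map_pow, map_ofNat]
    linear_combination (x ^ 2 + algebraMap ℚ K T * x + algebraMap ℚ K N) * hquad
  -- clear denominators: `T₂ = T₂.num / T₂.den`
  refine ⟨(T₂.den : ℤ), T₂.num, by exact_mod_cast T₂.den_nz, ?_⟩
  apply NumberField.RingOfIntegers.coe_injective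
  have hTK : algebraMap ℚ K T₂ * (T₂.den : K) = (T₂.num : K) := by
    rw [← map_natCast (algebraMap ℚ K), ← map_mul, Rat.mul_den_eq_num, map_intCast]
  simp only [map_add, map_sub, map_mul, map_pow, map_intCast, map_natCast, map_zero]
  rw [← NumberField.RingOfIntegers.coe_eq_algebraMap, ← hx]
  push_cast
  rw [← hTK]
  linear_combination (T₂.den : K) * hquart


/-- **The weight obstruction at a degree-one prime of a quadratic field (potentially good ordinary
cell).**  `[K:ℚ] = 2`, `𝔭` a prime of `𝓞_K` with `N(𝔭) = p`, `p ∈ 𝔭 ∖ 𝔭²`, `h ≥ 1`, `(π) = 𝔭^h`;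
`φ : 𝓞_K → R` an injective ring map into a field of characteristic `0` (the `𝔭`-adic embedding into
`ℚ_p`), `α ∈ R` with `α² = aα − p` (the unit root of the good ordinary twist).  Then
`s α^h φ(π)² ≠ p^{2h}` (`s = ±1`): the canonical character `ψ·ε·unr(α)⁻¹` does not take the value `1`
at the norm residue symbol of `π²/p^h` (cyclotomic character `p^{2h}/φ(π)²`, Frobenius degree `h`).
[cite: JetchevSkinnerWan2017, §3.3 Prop. 3.3.4 Case 3(b) (arXiv:1512.06894 p. 13)] -/
theorem ne_of_unitRoot_of_span_eq_pow (hK : Module.finrank ℚ K = 2) {𝔭 : Ideal (𝓞 K)}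
    (h𝔭 : 𝔭.IsPrime) {p : ℕ} (hp : p.Prime) (hN : Ideal.absNorm 𝔭 = p) (hp𝔭 : (p : 𝓞 K) ∈ 𝔭)
    (hp2 : (p : 𝓞 K) ∉ 𝔭 ^ 2) {h : ℕ} (hh : 0 < h) {π : 𝓞 K} (hπ : 𝔭 ^ h = Ideal.span {π})
    {R : Type*} [Field R] [CharZero R] (φ : 𝓞 K →+* R) (hφ : Function.Injective φ)
    {a : ℤ} {α : R} (hα : α ^ 2 = a * α - p) {s : ℤ} (hs : s = 1 ∨ s = -1) :
    (s : R) * α ^ h * φ π ^ 2 ≠ (p : R) ^ (2 * h) := by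
  obtain ⟨b, t, hb, hrel⟩ := exists_quartic_relation_of_finrank_eq_two hK hN hπ
  exact fun H ↦ false_of_unitRoot_sq_relation φ hφ hp hh hb hrel
    (sq_mul_ne_intCast_of_span_eq_pow hK h𝔭 hp hN hp𝔭 hp2 hh hπ) hα hs H

/-- **The weight obstruction, potentially multiplicative cell** (canonical character `±ε`):
`s φ(π)² ≠ p^{2h}` under the same hypotheses (indeed only `π² ∉ ℚ` is used).
[cite: JetchevSkinnerWan2017, §3.3 Prop. 3.3.4 Case 3(b), case (ii) (arXiv:1512.06894 p. 13)] -/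
theorem ne_of_span_eq_pow (hK : Module.finrank ℚ K = 2) {𝔭 : Ideal (𝓞 K)}
    (h𝔭 : 𝔭.IsPrime) {p : ℕ} (hp : p.Prime) (hN : Ideal.absNorm 𝔭 = p) (hp𝔭 : (p : 𝓞 K) ∈ 𝔭)
    (hp2 : (p : 𝓞 K) ∉ 𝔭 ^ 2) {h : ℕ} (hh : 0 < h) {π : 𝓞 K} (hπ : 𝔭 ^ h = Ideal.span {π})
    {R : Type*} [Field R] (φ : 𝓞 K →+* R) (hφ : Function.Injective φ)
    {s : ℤ} (hs : s = 1 ∨ s = -1) :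
    (s : R) * φ π ^ 2 ≠ (p : R) ^ (2 * h) :=
  fun H ↦ false_of_sq_relation φ hφ (sq_mul_ne_intCast_of_span_eq_pow hK h𝔭 hp hN hp𝔭 hp2 hh hπ) hs H

end Quadratic

end Summit.BirchSwinnertonDyer.BirchSwinnertonDyer.Theorems.SchneiderFreeAdditiveX3
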